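import Mathlib
import HarnessLib
import Summits.Ventures.LatticeQCDFlow.Scoring.DoeblinPowerBatchMeansCLT
import Summits.Ventures.LatticeQCDFlow.Scoring.TwoCodeAgreementInProbability

/-!
# The A-versus-B agreement test for two independent MARKOV-CHAIN runs with batch-means error
# bars, under Doeblin powers, from any initial laws:
# `(f̄_A,n − f̄_B,mₙ) / √(σ̂²_A,n/n + σ̂²_B,mₙ/mₙ) ⇒ N(0, 1)` whenever `π_A f_A = π_B f_B`

HONEST FRAMING: exact (Metropolis-corrected) sampling algorithms for lattice gauge theory;
figures of merit are autocorrelation/cost numbers at stated couplings and volumes; no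
continuum-physics claim.

Venture `LatticeQCDFlow` (cell pub-lqcd), topic `Scoring`; FANOUT row 8 (`s0-cpn-nemc`, GEN-22).
NEW WORK of the cell, not a published result; no definition is introduced; nothing is cited as a
fact.  The cell's acceptance criterion "A vs B within `1σ_comb`" compares a column printed by two
codes.  Row 4 typed the two-sample test for independent DRAWS (`Scoring/TwoCodeAgreement*.lean`)
and its abstract form with error bars consistent in probability
(`Scoring/TwoCodeAgreementInProbability.twoSample_agreement_clt_of_tendstoInMeasure`: one-code
CLTs `√n (Sₙ^X − a) ⇒ N(0, s_X)`, `s_X > 0`, `n·V̂ₙ^X → s_X` in probability, code `B` read along any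
`mₙ → ∞`).  When an arm is a CORRELATED run — HMC, a Metropolis / heat-bath sweep, the NCMC lane,
the exact flow sampler's Markov chain — its one-code CLT is row 13's time-average CLT under a
Doeblin power `(nHit κ m)(z,·) ≥ ε ν` from ANY initial law, and its printed squared standard error
is the batch-means `σ̂²_n/n` of the same run, consistent in probability from any start
(`Scoring/DoeblinPowerBatchMeans.lean`; batches `a_X(n)`, length `b_X(n)`, both `→ ∞`, e.g.
`a b ≤ n`).  This file composes them: for two INDEPENDENT chains (product of the two path laws)
with bounded measurable observables of equal target means `π_A f_A = π_B f_B` and positive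
asymptotic variances, any `mₙ → ∞` and EVERY pair of initial laws,
`(f̄_A,n − f̄_B,mₙ) / √(σ̂²_A,n/n + σ̂²_B,mₙ/mₙ) ⇒ N(0, 1)` — the combined-error-bar z-statistic of two
MCMC runs is asymptotically standard normal under the null, whatever the ratio of run lengths.
Printed counterparts NAMED ONLY: two-sample comparisons of MCMC estimates with batch-means /
spectral error bars (Flegal–Jones 2010; Vats–Flegal–Jones 2019), nothing cited as a fact.

## Content (`P^X_{μ_X}` the path laws; `f̄_X,n = Σ_{t<n} f_X(x_t)/n`; `σ̂²_X,n` the batch-means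
## estimator with `a_X(n)` batches of length `b_X(n)`)

* **`doeblinPower_twoChain_agreement_clt`** — for `Z ~ N(0,1)`:
  `TendstoInDistribution (fun n ω => (f̄_A,n(ω.1) − f̄_B,mₙ(ω.2)) / √(σ̂²_A,n(ω.1)/n + σ̂²_B,mₙ(ω.2)/mₙ))
  atTop Z (P^A_{μ_A} ⊗ P^B_{μ_B})`.

NOT CLAIMED: dependent arms (two observables of ONE run: `Scoring/MarkovChainBivariateCLT.lean`);
the power of the test under `π_A f_A ≠ π_B f_B`; degenerate variances; any number of ours.
-/

noncomputable section

namespace Summit.Ventures.LatticeQCDFlow.Scoring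

open MeasureTheory ProbabilityTheory Filter Finset Preorder
open scoped ENNReal Topology

/-- `√n · ((Σ_{t<n} a_t)/n − u) = (√n)⁻¹ · Σ_{t<n} (a_t − u)` for every `n`. -/
private theorem sqrt_mul_avg_sub' (c : ℕ → ℝ) (u : ℝ) (n : ℕ) :
    Real.sqrt n * ((∑ t ∈ Finset.range n, c t) / n - u)
      = (Real.sqrt n)⁻¹ * ∑ t ∈ Finset.range n, (c t - u) := by
  rcases Nat.eq_zero_or_pos n with hn | hn
  · subst hn; simp
  · have hnR : (0 : ℝ) < n := Nat.cast_pos.2 hn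
    have hs : (0 : ℝ) < Real.sqrt n := Real.sqrt_pos.2 hnR
    have hinv : (Real.sqrt n)⁻¹ = Real.sqrt n / n := by
      rw [eq_div_iff hnR.ne']
      calc (Real.sqrt n)⁻¹ * (n : ℝ) = (Real.sqrt n)⁻¹ * (Real.sqrt n * Real.sqrt n) := by
            rw [Real.mul_self_sqrt hnR.le]
        _ = Real.sqrt n := by rw [← mul_assoc, inv_mul_cancel₀ hs.ne', one_mul]
    rw [Finset.sum_sub_distrib, Finset.sum_const, Finset.card_range, nsmul_eq_mul, hinv]
    field_simp

section OneChain

variable {Ω : Type*} [MeasurableSpace Ω]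
  {κ : Kernel Ω Ω} [IsMarkovKernel κ] {ν : Measure Ω} [IsProbabilityMeasure ν] {ε : ℝ≥0∞} {m : ℕ}

/-- **One arm: the CLT of the time average in the `√n (f̄_n − πf)` form and the batch-means
squared standard error `σ̂²_n/n` with `n·(σ̂²_n/n) → σ²_f` in probability**, from any start, for
the limit variable `√σ²_f · Z` built from any `Z ~ N(0,1)`. -/
theorem doeblinPower_arm_clt_and_errorBar {π : Measure Ω} [IsProbabilityMeasure π]
    (hπ : Kernel.Invariant κ π) (hmin : ∀ z, ε • ν ≤ Exactness.nHit κ m z) (hε0 : 0 < ε)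
    (hε1 : ε ≤ 1) (hm : 0 < m) {f : Ω → ℝ} (hf : Measurable f) {C : ℝ} (hC : ∀ x, |f x| ≤ C)
    (hσ : 0 ≤ ((∫ y, (f y - ∫ z, f z ∂π) ^ 2 ∂π)
            + 2 * ∑' k, ∫ y, (f y - ∫ z, f z ∂π)
              * (kop κ)^[k + 1] (fun y => f y - ∫ z, f z ∂π) y ∂π))
    (μ₀ : Measure Ω) [IsProbabilityMeasure μ₀] {a b : ℕ → ℕ} (ha : Tendsto a atTop atTop)
    (hb : Tendsto b atTop atTop)
    {Ω' : Type*} [MeasurableSpace Ω'] {P' : Measure Ω'} [IsProbabilityMeasure P'] {Z : Ω' → ℝ}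
    (hZ : HasLaw Z (gaussianReal 0 1) P')
    [IsProbabilityMeasure (Kernel.trajMeasure (X := fun _ : ℕ => Ω) μ₀
          (fun n : ℕ => κ.comap
            (fun h : (i : ↥(Finset.Iic n)) → Ω => h ⟨n, Finset.mem_Iic.2 le_rfl⟩)
            (measurable_pi_apply _)))] :
    TendstoInDistribution (fun (n : ℕ) (x : ℕ → Ω) =>
        Real.sqrt n * ((∑ t ∈ Finset.range n, f (x t)) / n - ∫ z, f z ∂π))
      atTop (fun ω => Real.sqrt ((∫ y, (f y - ∫ z, f z ∂π) ^ 2 ∂π)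
            + 2 * ∑' k, ∫ y, (f y - ∫ z, f z ∂π)
              * (kop κ)^[k + 1] (fun y => f y - ∫ z, f z ∂π) y ∂π) * Z ω)
      (fun _ => (Kernel.trajMeasure (X := fun _ : ℕ => Ω) μ₀
          (fun n : ℕ => κ.comap
            (fun h : (i : ↥(Finset.Iic n)) → Ω => h ⟨n, Finset.mem_Iic.2 le_rfl⟩)
            (measurable_pi_apply _)))) P' ∧
    TendstoInMeasure (Kernel.trajMeasure (X := fun _ : ℕ => Ω) μ₀
          (fun n : ℕ => κ.comap
            (fun h : (i : ↥(Finset.Iic n)) → Ω => h ⟨n, Finset.mem_Iic.2 le_rfl⟩)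
            (measurable_pi_apply _)))
      (fun (n : ℕ) (x : ℕ → Ω) => (n : ℝ) *
        ((((b n * a n : ℕ) : ℝ) * replicaSEsq (fun j (x : ℕ → Ω) =>
          (∑ i ∈ Finset.range (b n), f (x (b n * j + i))) / (b n)) (a n) x) / n))
      atTop (fun _ => ((∫ y, (f y - ∫ z, f z ∂π) ^ 2 ∂π)
            + 2 * ∑' k, ∫ y, (f y - ∫ z, f z ∂π)
              * (kop κ)^[k + 1] (fun y => f y - ∫ z, f z ∂π) y ∂π)) := by
  obtain ⟨σ2, hσ2⟩ : ∃ s : ℝ, s = ((∫ y, (f y - ∫ z, f z ∂π) ^ 2 ∂π)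
            + 2 * ∑' k, ∫ y, (f y - ∫ z, f z ∂π)
              * (kop κ)^[k + 1] (fun y => f y - ∫ z, f z ∂π) y ∂π) := ⟨_, rfl⟩
  rw [← hσ2] at hσ ⊢
  -- the limit variable `√σ² · Z ~ N(0, σ²)`
  have hY₁ : HasLaw (fun ω => Real.sqrt σ2 * Z ω) (gaussianReal 0 σ2.toNNReal) P' := by
    refine ⟨hZ.aemeasurable.const_mul _, ?_⟩
    rw [show (fun ω => Real.sqrt σ2 * Z ω) = (fun a : ℝ => Real.sqrt σ2 * a) ∘ Z from rfl,
      ← AEMeasurable.map_map_of_aemeasurable (measurable_const_mul _).aemeasurable hZ.aemeasurable,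
      hZ.map_eq, gaussianReal_map_const_mul, mul_zero, mul_one]
    congr 1
    apply NNReal.coe_injective
    rw [NNReal.coe_mk, Real.coe_toNNReal _ hσ, Real.sq_sqrt hσ]
  have hY₁' : HasLaw (fun ω => Real.sqrt σ2 * Z ω) (gaussianReal 0 (Real.toNNReal
      ((∫ y, (f y - ∫ z, f z ∂π) ^ 2 ∂π)
            + 2 * ∑' k, ∫ y, (f y - ∫ z, f z ∂π)
              * (kop κ)^[k + 1] (fun y => f y - ∫ z, f z ∂π) y ∂π))) P' := by
    rw [← hσ2]; exact hY₁
  have hclt := Exactness.GeneralNCMC.tendstoInDistribution_timeAverage_of_nHit hπ hε0.ne' hmin hm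
    hf hC μ₀ hY₁'
  refine ⟨hclt.congr (fun n => Eventually.of_forall fun x =>
    (sqrt_mul_avg_sub' (fun t => f (x t)) _ n).symm) EventuallyEq.rfl, ?_⟩
  have hV := chain_batchMeans_sigmaHat_tendstoInMeasure_of_nHit hπ
    (Exactness.GeneralNCMC.minorised_setwise hmin) hε0 hε1 hm hf hC μ₀ ha hb
  rw [← hσ2] at hV
  refine hV.congr' ?_ EventuallyEq.rfl
  filter_upwards [eventually_ge_atTop 1] with n hn
  exact Eventually.of_forall fun x => by
    show _ = (n : ℝ) * (_ / n)
    rw [mul_div_cancel₀ _ (Nat.cast_ne_zero.2 (by omega))]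

end OneChain

section TwoChains

variable {ΩA : Type*} [MeasurableSpace ΩA] {κA : Kernel ΩA ΩA} [IsMarkovKernel κA]
  {νA : Measure ΩA} [IsProbabilityMeasure νA] {εA : ℝ≥0∞} {mA : ℕ}
variable {ΩB : Type*} [MeasurableSpace ΩB] {κB : Kernel ΩB ΩB} [IsMarkovKernel κB]
  {νB : Measure ΩB} [IsProbabilityMeasure νB] {εB : ℝ≥0∞} {mB : ℕ}

/-- **THE TWO-CHAIN AGREEMENT TEST, FROM ANY INITIAL LAWS.**  Two independent runs: chain `A`
(`π_A` invariant, `(nHit κ_A m_A)(z,·) ≥ ε_A ν_A`, `0 < ε_A ≤ 1`, `0 < m_A`, `|f_A| ≤ C_A` measurable,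
`σ²_A > 0`, batches `a_A(n), b_A(n) → ∞`, initial law `μ_A`) and chain `B` likewise, read along any
`mₙ → ∞`; equal target means `π_A f_A = π_B f_B`; `Z ~ N(0, 1)`.  Then on the product of the two
path laws: `(f̄_A,n − f̄_B,mₙ) / √(σ̂²_A,n/n + σ̂²_B,mₙ/mₙ) ⇒ Z`. -/
theorem doeblinPower_twoChain_agreement_clt
    {πA : Measure ΩA} [IsProbabilityMeasure πA] (hπA : Kernel.Invariant κA πA)
    (hminA : ∀ z, εA • νA ≤ Exactness.nHit κA mA z) (hεA0 : 0 < εA) (hεA1 : εA ≤ 1) (hmA : 0 < mA)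
    {fA : ΩA → ℝ} (hfA : Measurable fA) {CA : ℝ} (hCA : ∀ x, |fA x| ≤ CA)
    (hσA : 0 < ((∫ y, (fA y - ∫ z, fA z ∂πA) ^ 2 ∂πA)
            + 2 * ∑' k, ∫ y, (fA y - ∫ z, fA z ∂πA)
              * (kop κA)^[k + 1] (fun y => fA y - ∫ z, fA z ∂πA) y ∂πA))
    (μA : Measure ΩA) [IsProbabilityMeasure μA] {aA bA : ℕ → ℕ} (haA : Tendsto aA atTop atTop)
    (hbA : Tendsto bA atTop atTop)
    [IsProbabilityMeasure (Kernel.trajMeasure (X := fun _ : ℕ => ΩA) μA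
          (fun n : ℕ => κA.comap
            (fun h : (i : ↥(Finset.Iic n)) → ΩA => h ⟨n, Finset.mem_Iic.2 le_rfl⟩)
            (measurable_pi_apply _)))]
    {πB : Measure ΩB} [IsProbabilityMeasure πB] (hπB : Kernel.Invariant κB πB)
    (hminB : ∀ z, εB • νB ≤ Exactness.nHit κB mB z) (hεB0 : 0 < εB) (hεB1 : εB ≤ 1) (hmB : 0 < mB)
    {fB : ΩB → ℝ} (hfB : Measurable fB) {CB : ℝ} (hCB : ∀ x, |fB x| ≤ CB)
    (hσB : 0 < ((∫ y, (fB y - ∫ z, fB z ∂πB) ^ 2 ∂πB)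
            + 2 * ∑' k, ∫ y, (fB y - ∫ z, fB z ∂πB)
              * (kop κB)^[k + 1] (fun y => fB y - ∫ z, fB z ∂πB) y ∂πB))
    (μB : Measure ΩB) [IsProbabilityMeasure μB] {aB bB : ℕ → ℕ} (haB : Tendsto aB atTop atTop)
    (hbB : Tendsto bB atTop atTop)
    [IsProbabilityMeasure (Kernel.trajMeasure (X := fun _ : ℕ => ΩB) μB
          (fun n : ℕ => κB.comap
            (fun h : (i : ↥(Finset.Iic n)) → ΩB => h ⟨n, Finset.mem_Iic.2 le_rfl⟩)
            (measurable_pi_apply _)))]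
    (hmean : ∫ z, fA z ∂πA = ∫ z, fB z ∂πB) {m : ℕ → ℕ} (hm : Tendsto m atTop atTop)
    {Ω' : Type*} [MeasurableSpace Ω'] {P' : Measure Ω'} [IsProbabilityMeasure P'] {Z : Ω' → ℝ}
    (hZ : HasLaw Z (gaussianReal 0 1) P') :
    TendstoInDistribution (fun (n : ℕ) (ω : (ℕ → ΩA) × (ℕ → ΩB)) =>
        ((∑ t ∈ Finset.range n, fA (ω.1 t)) / n
            - (∑ t ∈ Finset.range (m n), fB (ω.2 t)) / (m n))
          / Real.sqrt ((((bA n * aA n : ℕ) : ℝ) * replicaSEsq (fun j (x : ℕ → ΩA) =>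
              (∑ i ∈ Finset.range (bA n), fA (x (bA n * j + i))) / (bA n)) (aA n) ω.1) / n
            + (((bB (m n) * aB (m n) : ℕ) : ℝ) * replicaSEsq (fun j (x : ℕ → ΩB) =>
              (∑ i ∈ Finset.range (bB (m n)), fB (x (bB (m n) * j + i)))
              / (bB (m n))) (aB (m n)) ω.2) / (m n)))
      atTop Z (fun _ => ((Kernel.trajMeasure (X := fun _ : ℕ => ΩA) μA
          (fun n : ℕ => κA.comap
            (fun h : (i : ↥(Finset.Iic n)) → ΩA => h ⟨n, Finset.mem_Iic.2 le_rfl⟩)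
            (measurable_pi_apply _)))).prod
        (Kernel.trajMeasure (X := fun _ : ℕ => ΩB) μB
          (fun n : ℕ => κB.comap
            (fun h : (i : ↥(Finset.Iic n)) → ΩB => h ⟨n, Finset.mem_Iic.2 le_rfl⟩)
            (measurable_pi_apply _)))) P' := by
  obtain ⟨hcltA, hVA⟩ := doeblinPower_arm_clt_and_errorBar hπA hminA hεA0 hεA1 hmA hfA hCA hσA.le
    μA haA hbA hZ
  obtain ⟨hcltB, hVB⟩ := doeblinPower_arm_clt_and_errorBar hπB hminB hεB0 hεB1 hmB hfB hCB hσB.le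
    μB haB hbB hZ
  have hcltB' : TendstoInDistribution (fun (n : ℕ) (x : ℕ → ΩB) =>
      Real.sqrt n * ((∑ t ∈ Finset.range n, fB (x t)) / n - ∫ z, fA z ∂πA))
      atTop (fun ω => Real.sqrt ((∫ y, (fB y - ∫ z, fB z ∂πB) ^ 2 ∂πB)
            + 2 * ∑' k, ∫ y, (fB y - ∫ z, fB z ∂πB)
              * (kop κB)^[k + 1] (fun y => fB y - ∫ z, fB z ∂πB) y ∂πB) * Z ω)
      (fun _ => (Kernel.trajMeasure (X := fun _ : ℕ => ΩB) μB
          (fun n : ℕ => κB.comap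
            (fun h : (i : ↥(Finset.Iic n)) → ΩB => h ⟨n, Finset.mem_Iic.2 le_rfl⟩)
            (measurable_pi_apply _)))) P' := by
    rw [hmean]; exact hcltB
  have hZA : HasLaw (fun ω => Real.sqrt ((∫ y, (fA y - ∫ z, fA z ∂πA) ^ 2 ∂πA)
            + 2 * ∑' k, ∫ y, (fA y - ∫ z, fA z ∂πA)
              * (kop κA)^[k + 1] (fun y => fA y - ∫ z, fA z ∂πA) y ∂πA) * Z ω)
      (gaussianReal 0 (Real.toNNReal ((∫ y, (fA y - ∫ z, fA z ∂πA) ^ 2 ∂πA)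
            + 2 * ∑' k, ∫ y, (fA y - ∫ z, fA z ∂πA)
              * (kop κA)^[k + 1] (fun y => fA y - ∫ z, fA z ∂πA) y ∂πA))) P' := by
    refine ⟨hZ.aemeasurable.const_mul _, ?_⟩
    rw [show (fun ω => Real.sqrt ((∫ y, (fA y - ∫ z, fA z ∂πA) ^ 2 ∂πA)
            + 2 * ∑' k, ∫ y, (fA y - ∫ z, fA z ∂πA)
              * (kop κA)^[k + 1] (fun y => fA y - ∫ z, fA z ∂πA) y ∂πA) * Z ω)
        = (fun a : ℝ => Real.sqrt ((∫ y, (fA y - ∫ z, fA z ∂πA) ^ 2 ∂πA)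
            + 2 * ∑' k, ∫ y, (fA y - ∫ z, fA z ∂πA)
              * (kop κA)^[k + 1] (fun y => fA y - ∫ z, fA z ∂πA) y ∂πA) * a) ∘ Z from rfl,
      ← AEMeasurable.map_map_of_aemeasurable (measurable_const_mul _).aemeasurable hZ.aemeasurable,
      hZ.map_eq, gaussianReal_map_const_mul, mul_zero, mul_one]
    congr 1
    apply NNReal.coe_injective
    rw [NNReal.coe_mk, Real.coe_toNNReal _ hσA.le, Real.sq_sqrt hσA.le]
  have hZB : HasLaw (fun ω => Real.sqrt ((∫ y, (fB y - ∫ z, fB z ∂πB) ^ 2 ∂πB)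
            + 2 * ∑' k, ∫ y, (fB y - ∫ z, fB z ∂πB)
              * (kop κB)^[k + 1] (fun y => fB y - ∫ z, fB z ∂πB) y ∂πB) * Z ω)
      (gaussianReal 0 (Real.toNNReal ((∫ y, (fB y - ∫ z, fB z ∂πB) ^ 2 ∂πB)
            + 2 * ∑' k, ∫ y, (fB y - ∫ z, fB z ∂πB)
              * (kop κB)^[k + 1] (fun y => fB y - ∫ z, fB z ∂πB) y ∂πB))) P' := by
    refine ⟨hZ.aemeasurable.const_mul _, ?_⟩
    rw [show (fun ω => Real.sqrt ((∫ y, (fB y - ∫ z, fB z ∂πB) ^ 2 ∂πB)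
            + 2 * ∑' k, ∫ y, (fB y - ∫ z, fB z ∂πB)
              * (kop κB)^[k + 1] (fun y => fB y - ∫ z, fB z ∂πB) y ∂πB) * Z ω)
        = (fun a : ℝ => Real.sqrt ((∫ y, (fB y - ∫ z, fB z ∂πB) ^ 2 ∂πB)
            + 2 * ∑' k, ∫ y, (fB y - ∫ z, fB z ∂πB)
              * (kop κB)^[k + 1] (fun y => fB y - ∫ z, fB z ∂πB) y ∂πB) * a) ∘ Z from rfl,
      ← AEMeasurable.map_map_of_aemeasurable (measurable_const_mul _).aemeasurable hZ.aemeasurable,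
      hZ.map_eq, gaussianReal_map_const_mul, mul_zero, mul_one]
    congr 1
    apply NNReal.coe_injective
    rw [NNReal.coe_mk, Real.coe_toNNReal _ hσB.le, Real.sq_sqrt hσB.le]
  have hSAm : ∀ n : ℕ, Measurable fun x : ℕ → ΩA => (∑ t ∈ Finset.range n, fA (x t)) / (n : ℝ) :=
    fun n => (Finset.measurable_sum _ fun t _ => hfA.comp (measurable_pi_apply t)).div_const _
  have hSBm : ∀ n : ℕ, Measurable fun x : ℕ → ΩB => (∑ t ∈ Finset.range n, fB (x t)) / (n : ℝ) :=
    fun n => (Finset.measurable_sum _ fun t _ => hfB.comp (measurable_pi_apply t)).div_const _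
  have hVAm : ∀ n : ℕ, Measurable fun x : ℕ → ΩA =>
      (((bA n * aA n : ℕ) : ℝ) * replicaSEsq (fun j (x : ℕ → ΩA) =>
              (∑ i ∈ Finset.range (bA n), fA (x (bA n * j + i))) / (bA n)) (aA n) x) / (n : ℝ)
      := fun n =>
    (measurable_batchMeans_sigmaHat hfA (aA n) (bA n)).div_const _
  have hVBm : ∀ n : ℕ, Measurable fun x : ℕ → ΩB =>
      (((bB n * aB n : ℕ) : ℝ) * replicaSEsq (fun j (x : ℕ → ΩB) =>
              (∑ i ∈ Finset.range (bB n), fB (x (bB n * j + i))) / (bB n)) (aB n) x) / (n : ℝ)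
      := fun n =>
    (measurable_batchMeans_sigmaHat hfB (aB n) (bB n)).div_const _
  exact CardConsistency.twoSample_agreement_clt_of_tendstoInMeasure hσA hσB hSAm hVAm hSBm hVBm
    hcltA hZA hcltB' hZB hVA hVB hm hZ

end TwoChains

end Summit.Ventures.LatticeQCDFlow.Scoring

end
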